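import Summits.Ventures.HodgeRepro2.T6B4Main

/-!
# T6B4Vertex — the vertices: the non-primitive vertex `T₄` and `T₄⁻¹ = T₄` (Tier 6, sub-goal B4)

Cell pub-hodge-repro2, owner t6-p7 (route/T6-B4-t6-p7.md). TIER4 §B4, B3 Application (ii): the one
non-primitive vertex of the parity tetrahedron is induced from the imaginary quadratic subfield
`F₀ ⊆ F`, `T₄ = {σ ∈ Σ : σ|_{F₀} = ψ₀}`; for it `T₄⁻¹ = T₄` (`inverseType_inducedSet_singleton`),
and under (Eq) + (D) with `Φ_μ = T₄` the CM type `Φ̃(τ₁)` of `M̃_μ` is induced from `(F₀′, {ψ₀*})`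
(`B4_inducedVertex`: in the kernel's coordinates `Φ̃(τ₁) = {θ : θ ∘ ι₀ = ψ₀}` through the embedding
`ι₀ : F₀ → M̃_μ` over `τ₁|_{F₀}`, i.e. `inducedSet {ψ₀}` for the pair `F₀ → M̃_μ`) — Lemma B4.4's
hypothesis with `(M̃, K, T) = (M̃_μ, F₀′, {ψ₀*})`. The involution `c` of `F₀` with `ψ₀ = τ₁|_{F₀} ∘ c`
exists for every quadratic Galois `F₀` (`exists_involution_of_finrank_two`: Gal(F₀/ℚ) of order 2).
The primitive vertices are `B4_primitive` (T6B4Main.lean); the identification of which vertex of the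
parity tetrahedron is the non-primitive one, and that its reflex field is quadratic, is p1's
`card_nonPrimitive_parityTetrahedron` / `finrank_reflexFieldOf_eq_two_of_not_isPrimitiveOn`.
Proof lane: 0 sorry; axioms ⊆ {propext, Classical.choice, Quot.sound}.
§8(d): uses an L-value-free non-vanishing device: NO.
-/

namespace Summit.Ventures.HodgeRepro2.T6.B4Vertex

open Summit.Ventures.HodgeRepro2 Summit.Ventures.HodgeRepro2.T6.B4Interface
  Summit.Ventures.HodgeRepro2.T6.B4Main

variable {K : Type*} [Field K] [NumberField K]

/-- The CM type of `K` induced from `(F₀, {ψ₀})`, `T = {σ ∈ Σ : σ|_{F₀} = ψ₀}` (p1's `inducedSet`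
for the pair `F₀ ⊆ K`), membership unfolded. -/
theorem mem_inducedSet_singleton_iff (F₀ : IntermediateField ℚ K) (ψ₀ : F₀ →+* ℂ)
    (σ : K →+* ℂ) :
    σ ∈ inducedSet (K := F₀) (L := K) {ψ₀} ↔ σ.comp (algebraMap F₀ K) = ψ₀ := by
  rw [mem_inducedSet_iff, Set.mem_singleton_iff]

/-- **Every embedding of a quadratic Galois subfield differs from a given one by an involution**:
for `F₀ ⊆ K` Galois over ℚ of degree 2 and embeddings `ρ, ψ₀ : F₀ →+* ℂ`, there is `c ∈ Aut(F₀)`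
with `c ∘ c = id` and `ψ₀ = ρ ∘ c` (Gal(F₀/ℚ) has order 2 and acts transitively on the embeddings,
`galEmb`). This is the «u|_{F₀} ∈ Gal(F₀/ℚ) has order ≤ 2» sentence of B3 Application (ii). -/
theorem exists_involution_of_finrank_two (F₀ : IntermediateField ℚ K) [IsGalois ℚ F₀]
    (h2 : Module.finrank ℚ F₀ = 2) (ρ ψ₀ : F₀ →+* ℂ) :
    ∃ c : F₀ ≃+* F₀, (∀ x, c (c x) = x) ∧ ψ₀ = ρ.comp (c : F₀ →+* F₀) := by
  obtain ⟨u, hu⟩ := (galEmb F₀ ρ).surjective ψ₀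
  rw [galEmb_apply] at hu
  have hcard : Nat.card (F₀ ≃ₐ[ℚ] F₀) = 2 := by
    rw [IsGalois.card_aut_eq_finrank, h2]
  have hu2 : u * u = 1 := by
    have := pow_card_eq_one' (x := u)
    rwa [hcard, pow_two] at this
  refine ⟨u.toRingEquiv, fun x => ?_, hu.symm⟩
  have := congrArg (fun v : F₀ ≃ₐ[ℚ] F₀ => v x) hu2
  simpa using this

/-- **`T₄⁻¹ = T₄`** (B3 Application (ii), first step): the CM type induced from `(F₀, {ψ₀})` with
`ψ₀ = τ₁|_{F₀} ∘ c`, `c` an involution of `F₀`, is stable under inversion with respect to `τ₁`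
(for `τ₁ ∘ u ∈ T₄`, `u` restricts to `c` on `F₀`, hence so does `u⁻¹`). -/
theorem inverseType_inducedSet_singleton [IsGalois ℚ K] (τ₁ : K →+* ℂ)
    (F₀ : IntermediateField ℚ K)
    (ψ₀ : F₀ →+* ℂ) (c : F₀ ≃+* F₀) (hc : ∀ x, c (c x) = x)
    (hψ : ψ₀ = (τ₁.comp (algebraMap F₀ K)).comp (c : F₀ →+* F₀)) :
    inverseType K τ₁ (inducedSet (K := F₀) (L := K) {ψ₀}) =
      inducedSet (K := F₀) (L := K) {ψ₀} := by
  -- the key step: τ₁ ∘ u ∈ T₄ → τ₁ ∘ u⁻¹ ∈ T₄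
  have key : ∀ u : K ≃ₐ[ℚ] K, galEmb K τ₁ u ∈ inducedSet (K := F₀) (L := K) {ψ₀} →
      galEmb K τ₁ u⁻¹ ∈ inducedSet (K := F₀) (L := K) {ψ₀} := by
    intro u hu
    rw [mem_inducedSet_singleton_iff, galEmb_apply] at hu ⊢
    have hux : ∀ x : F₀, u (x : K) = ((c x : F₀) : K) := by
      intro x
      apply τ₁.injective
      have := RingHom.congr_fun hu x
      simp only [RingHom.coe_comp, Function.comp_apply, hψ, IntermediateField.algebraMap_apply] at this
      simpa using this
    ext x
    simp only [RingHom.coe_comp, Function.comp_apply, hψ, IntermediateField.algebraMap_apply]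
    congr 1
    have h1 : u ((c x : F₀) : K) = (x : K) := by rw [hux (c x), hc]
    calc (u⁻¹ : K ≃ₐ[ℚ] K) (x : K) = (u⁻¹ : K ≃ₐ[ℚ] K) (u ((c x : F₀) : K)) := by rw [h1]
      _ = ((c x : F₀) : K) := by simp
  ext σ
  obtain ⟨u, rfl⟩ := (galEmb K τ₁).surjective σ
  rw [mem_inverseType_iff]
  constructor
  · intro h
    simpa using key u⁻¹ h
  · exact key u

/-- **B3 Application (ii), the non-primitive vertex**: let `T₄ = {σ : σ|_{F₀} = ψ₀}` be induced from
the subfield `F₀ ⊆ F` with `ψ₀ = τ₁|_{F₀} ∘ c` (`c` an involution of `F₀` — automatic for `F₀`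
quadratic, `exists_involution_of_finrank_two`), and let `ι₀ : F₀ → M̃_μ` be the embedding over
`τ₁|_{F₀}` (`F₀′ = M_μ ⊆ M̃_μ`, Lemma B4.2(ii) + Liu p. 41 l. 49). Under (Eq) and (D) for
`Φ_μ = T₄`, `Φ̃(τ₁)` is the CM type of `M̃_μ` induced from `(F₀′, {ψ₀*})` — in the kernel's
coordinates: `Φ̃(τ₁) = {θ : θ ∘ ι₀ = ψ₀}` (Liu's «induced CM type Ψ_μ» for this vertex),
Lemma B4.4's hypothesis with `(M̃, K, T) = (M̃_μ, F₀′, {ψ₀*})`. -/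
theorem B4_inducedVertex [IsGalois ℚ K] (τ₁ : K →+* ℂ)
    (F₀ : IntermediateField ℚ K) (ψ₀ : F₀ →+* ℂ)
    (c : F₀ ≃+* F₀) (hc : ∀ x, c (c x) = x)
    (hψ : ψ₀ = (τ₁.comp (algebraMap F₀ K)).comp (c : F₀ →+* F₀))
    (M : IntermediateField ℚ ℂ) [FiniteDimensional ℚ M] (ι₀ : F₀ →+* M)
    (hι₀ : (algebraMap M ℂ).comp ι₀ = τ₁.comp (algebraMap F₀ K))
    (Φt : (K →+* ℂ) → Set (M →+* ℂ)) (hEq : EqCompat M Φt)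
    (hD : HodgeDictionary M (inducedSet (K := F₀) (L := K) {ψ₀}) Φt) :
    Φt τ₁ = @inducedSet F₀ _ M _ ι₀.toAlgebra {ψ₀} := by
  letI : Algebra F₀ M := ι₀.toAlgebra
  ext θ
  obtain ⟨g, hg⟩ := exists_extension M θ
  rw [mem_iff_of_extends hEq hD τ₁ θ g hg, mem_inducedSet_singleton_iff,
    mem_inducedSet_iff, Set.mem_singleton_iff]
  have hι : (algebraMap F₀ M : F₀ →+* M) = ι₀ := rfl
  rw [hι]
  -- ρ := τ₁|_{F₀}; θ ∘ ι₀ = g ∘ ρ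
  have hθ : θ.comp ι₀ = (g : ℂ →+* ℂ).comp (τ₁.comp (algebraMap F₀ K)) := by
    rw [← hι₀, ← RingHom.comp_assoc]
    congr 1
    ext x
    exact (hg x).symm
  rw [hθ, RingHom.comp_assoc, hψ]
  constructor
  · intro h
    ext x
    have := RingHom.congr_fun h (c x)
    simp only [RingHom.coe_comp, Function.comp_apply, RingHom.coe_coe, hc] at this
    simp only [RingHom.coe_comp, Function.comp_apply, RingHom.coe_coe]
    rw [← this, RingEquiv.apply_symm_apply]
  · intro h
    ext x
    have := RingHom.congr_fun h (c x)
    simp only [RingHom.coe_comp, Function.comp_apply, RingHom.coe_coe, hc] at this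
    simp only [RingHom.coe_comp, Function.comp_apply, RingHom.coe_coe]
    rw [← this, RingEquiv.symm_apply_apply]

/-! ### The fibre form of Prop. B4.3(2): «ALL … when σ ∈ Φ_μ⁻¹, NONE when σ ∉ Φ_μ⁻¹» -/

/-- For `σ ∈ Φ_μ⁻¹`, EVERY embedding of `M̃_μ` above `σ` lies in `Φ̃(τ₁)`. -/
theorem fibre_subset_of_mem [IsGalois ℚ K] (τ₁ : K →+* ℂ) (Φμ : Set (K →+* ℂ))
    (M : IntermediateField ℚ ℂ) [FiniteDimensional ℚ M] [Algebra K M]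
    (hτ : (algebraMap M ℂ).comp (algebraMap K M) = τ₁)
    (Φt : (K →+* ℂ) → Set (M →+* ℂ)) (hEq : EqCompat M Φt) (hD : HodgeDictionary M Φμ Φt)
    {σ : K →+* ℂ} (hσ : σ ∈ inverseType K τ₁ Φμ) : fibre (L := M) σ ⊆ Φt τ₁ := fun θ hθ =>
  (fibre_subset_iff τ₁ Φμ M hτ Φt hEq hD σ θ hθ).2 hσ

/-- For `σ ∉ Φ_μ⁻¹`, NO embedding of `M̃_μ` above `σ` lies in `Φ̃(τ₁)`. -/
theorem disjoint_fibre_of_not_mem [IsGalois ℚ K] (τ₁ : K →+* ℂ) (Φμ : Set (K →+* ℂ))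
    (M : IntermediateField ℚ ℂ) [FiniteDimensional ℚ M] [Algebra K M]
    (hτ : (algebraMap M ℂ).comp (algebraMap K M) = τ₁)
    (Φt : (K →+* ℂ) → Set (M →+* ℂ)) (hEq : EqCompat M Φt) (hD : HodgeDictionary M Φμ Φt)
    {σ : K →+* ℂ} (hσ : σ ∉ inverseType K τ₁ Φμ) : Disjoint (fibre (L := M) σ) (Φt τ₁) :=
  Set.disjoint_left.2 fun θ hθ hmem =>
    hσ ((fibre_subset_iff τ₁ Φμ M hτ Φt hEq hD σ θ hθ).1 hmem)

/-- `Φ̃(τ₁)` is the disjoint union of the fibres above `σ ∈ Φ_μ⁻¹` (p1's `inducedSet_eq_iUnion`). -/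
theorem eq_iUnion_fibre [IsGalois ℚ K] (τ₁ : K →+* ℂ) (Φμ : Set (K →+* ℂ))
    (M : IntermediateField ℚ ℂ) [FiniteDimensional ℚ M] [Algebra K M]
    (hτ : (algebraMap M ℂ).comp (algebraMap K M) = τ₁)
    (Φt : (K →+* ℂ) → Set (M →+* ℂ)) (hEq : EqCompat M Φt) (hD : HodgeDictionary M Φμ Φt) :
    Φt τ₁ = ⋃ σ ∈ inverseType K τ₁ Φμ, fibre (L := M) σ := by
  have h := B4_main τ₁ Φμ M hτ Φt hEq hD
  unfold InverseTypeForced at h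
  rw [h, inducedSet_eq_iUnion]

end Summit.Ventures.HodgeRepro2.T6.B4Vertex
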